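import Literature.Analysis.Complex.JensenPolynomialHyperbolicity
import Literature.NumberTheory.LFunctions.JensenHermite
import HarnessLib

/-!
# The differentiation flow on the Jensen grid, I: shift rule and the degree-aware Laguerre (Newton)
# inequality along anti-diagonals — necessity of the flow invariant (all proved)

Trunk T-CA (`Literature/Analysis/Complex`), namespace `Literature.Analysis.Complex.JensenLaguerreFlow`;
companion of `JensenPolynomialHyperbolicity.lean` (Pólya–Schur / Craven–Csordas theory of the Jensen
polynomials `J^{d,n}_γ(X) = Σ_{j ≤ d} (d choose j) γ(n+j) Xʲ`, the tree's
`Literature.NumberTheory.LFunctions.jensenPoly`, [GORZPNAS2019, §1]). Part II (sufficiency by inverse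
Rolle, and the RH-EQUIVALENT `ξ` reading) is `JensenLaguerreFlowSufficiency.lean`.

The Jensen grid `(d, n)` carries a FLOW: `(J^{d+1,n}_γ)′ = (d+1)·J^{d,n+1}_γ` (Craven–Csordas'
`g′_{n,p} = n g_{n-1,p+1}` [CravenCsordas1989, §2]), so the anti-diagonals `d + n = N` are
differentiation orbits and the base `J^{1,n}` is always hyperbolic. Along an orbit the natural
invariant is the ANTI-DIAGONAL TURÁN DETERMINANT
`D_{d+2,n} := (J^{d+1,n+1}_γ)² − J^{d+2,n}_γ · J^{d,n+2}_γ = [(d+1)(p′)² − (d+2) p p″]/((d+2)²(d+1))`,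
`p = J^{d+2,n}_γ` — the degree-aware Laguerre form.

* `derivative_jensenPoly_succ`, `derivative_derivative_jensenPoly` (+ evaluated forms) — the shift
  rule (flow).
* `laguerre_newton_of_splits` — **the degree-aware Laguerre inequality**: for a real-rooted `p` with
  `deg p ≤ m`, `(m−1)p′(x)² − m·p(x)p″(x) ≥ 0` for all real `x` (Newton's inequality `E₀E₂ ≤ E₁²`
  [Steele2004, (12.2)] for `p(x + ·)`; proved here by induction on the roots, the step being the
  sum-of-squares identity `(k−1)[(k−1)P′² − kPP″] = ((k−1)Q − tQ′)² + k t²[(k−2)Q′² − (k−1)QQ″]`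
  for `P = (X − a)Q`, `t = x − a`, `k = deg P`).
* `eval_antiTuranDet_nonneg_of_splits` — **necessity** (`FlowNecessity` of the cell memo, cell by
  cell): if `J^{d+2,n}_γ` is hyperbolic then `D_{d+2,n}(x) ≥ 0` for every real `x` (any real `γ`).

Provenance: cell rh-jensen (D-0074 GROUP I, transfer lens round 2, `LaguerreFlowSketch.lean` §1–§2,
planner-rh-jensen-idea-1-g2-0, 2026-08-26: the shift rule was proved there, `FlowNecessity` /
`FlowSufficiency` were STATED as prover-sized lemmas), landed by prover-rh-jensen-eng-2-g2-0.
AI-produced formalisation; AI review is weaker than expert review. RH-free; nothing here concerns `ξ`.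

## References
* [CravenCsordas1989] T. Craven, G. Csordas, *Jensen polynomials and the Turán and Laguerre
  inequalities*, Pacific J. Math. 136 (1989) 241–260, §1 (i), §2.
* [Steele2004] J. M. Steele, *The Cauchy–Schwarz Master Class*, Problem 12.1, (12.2) (Newton's
  inequalities; tree: `Literature.Analysis.TotalPositivity.Steele2004_newton_inequalities_holds`).
* [GORZPNAS2019] M. Griffin, K. Ono, L. Rolen, D. Zagier, PNAS 116 (2019) 11103–11110, §1.
-/

open Polynomial Finset

namespace Literature.Analysis.Complex.JensenLaguerreFlow

open Literature.NumberTheory.LFunctions Literature.Analysis.Complex.PolyaSchur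

/-! ## The flow: differentiation moves down the anti-diagonal -/

/-- **Shift rule.** `(J^{d+1,n}_γ)′ = (d+1) · J^{d,n+1}_γ`: differentiation moves one step down the
anti-diagonal `d + n = const` of the Jensen grid (Craven–Csordas' `g′_{n,p} = n·g_{n-1,p+1}` for
`g_{n,p}(t) = Σ_k (n choose k) γ_{k+p} t^k`). [cite: CravenCsordas1989, §2 (g′_{n,p} = n g_{n−1,p+1})] -/
theorem derivative_jensenPoly_succ (γ : ℕ → ℝ) (d n : ℕ) :
    derivative (jensenPoly γ (d + 1) n) = C ((d : ℝ) + 1) * jensenPoly γ d (n + 1) := by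
  ext j
  rw [coeff_derivative, coeff_C_mul, coeff_jensenPoly, coeff_jensenPoly]
  by_cases hj : j ≤ d
  · rw [if_pos (by omega), if_pos hj, show n + (j + 1) = n + 1 + j by ring]
    have h' : ((d : ℝ) + 1) * (d.choose j : ℝ) = ((d + 1).choose (j + 1) : ℝ) * ((j : ℝ) + 1) := by
      exact_mod_cast Nat.add_one_mul_choose_eq d j
    linear_combination (-(γ (n + 1 + j))) * h'
  · rw [if_neg (by omega), if_neg hj]; simp

/-- Iterated shift rule: `(J^{d+2,n}_γ)″ = (d+2)(d+1) · J^{d,n+2}_γ`.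
[cite: CravenCsordas1989, §2 (g′_{n,p} = n g_{n−1,p+1})] -/
theorem derivative_derivative_jensenPoly (γ : ℕ → ℝ) (d n : ℕ) :
    derivative (derivative (jensenPoly γ (d + 2) n)) =
      C (((d : ℝ) + 2) * ((d : ℝ) + 1)) * jensenPoly γ d (n + 2) := by
  rw [show d + 2 = (d + 1) + 1 by ring, derivative_jensenPoly_succ, derivative_C_mul,
    derivative_jensenPoly_succ, ← mul_assoc, ← C_mul]
  congr 2; push_cast; ring

/-! ## The degree-aware Laguerre inequality `(m−1)p′² − m·p·p″ ≥ 0` (Newton's inequality `k = 1`) -/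

/-- Core of the Laguerre–Newton inequality, for a monic product over a multiset of real roots
`P = ∏_{a ∈ s} (X − a)`: `(|s| − 1)·P′(x)² − |s|·P(x)·P″(x) ≥ 0` for every real `x`. Induction on
`s`: with `P = (X − a)Q`, `t = x − a`, `k = |s|`,
`(k−1)·[(k−1)P′² − kPP″] = ((k−1)Q − tQ′)² + k·t²·[(k−2)Q′² − (k−1)QQ″]`. [folklore] -/
private theorem laguerre_newton_prod (s : Multiset ℝ) (x : ℝ) :
    0 ≤ ((Multiset.card s : ℝ) - 1) * ((derivative (s.map (fun a => X - C a)).prod).eval x) ^ 2 -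
      (Multiset.card s : ℝ) * ((s.map (fun a => X - C a)).prod.eval x *
        (derivative (derivative (s.map (fun a => X - C a)).prod)).eval x) := by
  induction s using Multiset.induction_on with
  | empty => simp
  | cons a s ih =>
    set Q : ℝ[X] := (s.map (fun a => X - C a)).prod with hQ
    have hP : ((a ::ₘ s).map (fun a => X - C a)).prod = (X - C a) * Q := by
      rw [Multiset.map_cons, Multiset.prod_cons]
    have hd1 : derivative ((X - C a) * Q) = Q + (X - C a) * derivative Q := by
      rw [derivative_mul, derivative_X_sub_C, one_mul]
    have hd2 : derivative (derivative ((X - C a) * Q)) =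
        2 * derivative Q + (X - C a) * derivative (derivative Q) := by
      rw [hd1, derivative_add, derivative_mul, derivative_X_sub_C, one_mul]; ring
    have ih' : 0 ≤ ((Multiset.card s : ℝ) - 1) * ((derivative Q).eval x) ^ 2 -
        (Multiset.card s : ℝ) * (Q.eval x * (derivative (derivative Q)).eval x) := ih
    rcases (Multiset.card s).eq_zero_or_pos with h0 | hpos
    · -- `s = 0`: `Q = 1`, everything vanishes
      have hs : s = 0 := Multiset.card_eq_zero.mp h0
      subst hs
      simp
    · have hkpos : (0 : ℝ) < Multiset.card s := by exact_mod_cast hpos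
      rw [hP, Multiset.card_cons, hd2, hd1]
      simp only [eval_add, eval_mul, eval_sub, eval_X, eval_C, eval_ofNat, Nat.cast_add,
        Nat.cast_one]
      -- identity: k · target = (k·Q − t·Q′)² + (k+1)·t²·IH  (k = |s|, t = x − a)
      have hid : ∀ k t e0 e1 e2 : ℝ,
          k * ((k + 1 - 1) * (e0 + t * e1) ^ 2 - (k + 1) * (t * e0 * (2 * e1 + t * e2))) =
            (k * e0 - t * e1) ^ 2 + (k + 1) * t ^ 2 * ((k - 1) * e1 ^ 2 - k * (e0 * e2)) := by
        intro k t e0 e1 e2; ring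
      have h1 := sq_nonneg ((Multiset.card s : ℝ) * Q.eval x - (x - a) * (derivative Q).eval x)
      have h2 : 0 ≤ ((Multiset.card s : ℝ) + 1) * (x - a) ^ 2 *
          (((Multiset.card s : ℝ) - 1) * ((derivative Q).eval x) ^ 2 -
            (Multiset.card s : ℝ) * (Q.eval x * (derivative (derivative Q)).eval x)) :=
        mul_nonneg (by positivity) ih'
      have h3 := hid (Multiset.card s : ℝ) (x - a) (Q.eval x) ((derivative Q).eval x)
        ((derivative (derivative Q)).eval x)
      nlinarith [h1, h2, h3, hkpos]

/-- **The degree-aware Laguerre inequality** (Newton's inequality `E₀E₂ ≤ E₁²` for the shifted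
polynomial `p(x + ·)`): if the real polynomial `p` splits over `ℝ` and `deg p ≤ m`, then
`(m − 1)·p′(x)² − m·p(x)·p″(x) ≥ 0` for every real `x`. For `m = deg p` and `p(x) ≠ 0` this is
Cauchy–Schwarz for `Σ 1/(x − aᵢ)`; the slack `m ≥ deg p` costs the classical Laguerre inequality
`p′² − pp″ ≥ 0`. [cite: Steele2004, Problem 12.1 (12.2) (Newton's inequalities, k = 1)]
[cite: CravenCsordas1989, §1 (the Laguerre inequality L₁(p) = p′² − pp″ ≥ 0 on 𝓛𝓟)] -/
theorem laguerre_newton_of_splits {p : ℝ[X]} (hp : p.Splits) {m : ℕ} (hm : p.natDegree ≤ m)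
    (x : ℝ) :
    0 ≤ ((m : ℝ) - 1) * ((derivative p).eval x) ^ 2 -
      (m : ℝ) * (p.eval x * (derivative (derivative p)).eval x) := by
  have hrepr := hp.eq_prod_roots
  set lc : ℝ := p.leadingCoeff with hlc
  set P : ℝ[X] := (p.roots.map (X - C ·)).prod with hP
  have hk : p.natDegree = Multiset.card p.roots := hp.natDegree_eq_card_roots
  have h0 : p.eval x = lc * P.eval x := by
    rw [hrepr]; simp [eval_mul]
  have h1 : (derivative p).eval x = lc * (derivative P).eval x := by
    rw [hrepr, derivative_C_mul]; simp [eval_mul]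
  have h2 : (derivative (derivative p)).eval x = lc * (derivative (derivative P)).eval x := by
    rw [hrepr, derivative_C_mul, derivative_C_mul]; simp [eval_mul]
  -- the core inequality at `k = card roots = deg p`
  have hA := laguerre_newton_prod p.roots x
  rw [← hP] at hA
  set k : ℕ := Multiset.card p.roots with hkdef
  -- the classical Laguerre inequality `P′² − P P″ ≥ 0`
  have hB : 0 ≤ ((derivative P).eval x) ^ 2 - P.eval x * (derivative (derivative P)).eval x := by
    rcases k.eq_zero_or_pos with hk0 | hkpos
    · have hroots : p.roots = 0 := Multiset.card_eq_zero.mp hk0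
      have hP1 : P = 1 := by rw [hP, hroots]; simp
      simp [hP1]
    · have hkR : (0 : ℝ) < k := by exact_mod_cast hkpos
      nlinarith [hA, sq_nonneg ((derivative P).eval x)]
  have hmk : (k : ℝ) ≤ m := by exact_mod_cast (hk ▸ hm : k ≤ m)
  rw [h0, h1, h2]
  have hid : ((m : ℝ) - 1) * (lc * (derivative P).eval x) ^ 2 -
      (m : ℝ) * (lc * P.eval x * (lc * (derivative (derivative P)).eval x)) =
      lc ^ 2 * ((((k : ℝ) - 1) * ((derivative P).eval x) ^ 2 -
        (k : ℝ) * (P.eval x * (derivative (derivative P)).eval x)) +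
        ((m : ℝ) - k) * (((derivative P).eval x) ^ 2 -
          P.eval x * (derivative (derivative P)).eval x)) := by ring
  rw [hid]
  exact mul_nonneg (sq_nonneg _) (add_nonneg hA (mul_nonneg (sub_nonneg.mpr hmk) hB))

/-! ## Necessity: along the flow, hyperbolicity forces the anti-diagonal Turán determinant `≥ 0` -/

/-- `(J^{d+2,n}_γ)′(x) = (d+2)·J^{d+1,n+1}_γ(x)` (evaluated shift rule).
[cite: CravenCsordas1989, §2 (g′_{n,p} = n g_{n−1,p+1})] -/
theorem eval_derivative_jensenPoly_add_two (γ : ℕ → ℝ) (d n : ℕ) (x : ℝ) :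
    (derivative (jensenPoly γ (d + 2) n)).eval x =
      ((d : ℝ) + 2) * (jensenPoly γ (d + 1) (n + 1)).eval x := by
  have h := derivative_jensenPoly_succ γ (d + 1) n
  rw [show d + 1 + 1 = d + 2 from rfl] at h
  rw [h, eval_mul, eval_C]; push_cast; ring

/-- `(J^{d+2,n}_γ)″(x) = (d+2)(d+1)·J^{d,n+2}_γ(x)` (evaluated iterated shift rule).
[cite: CravenCsordas1989, §2 (g′_{n,p} = n g_{n−1,p+1})] -/
theorem eval_derivative_derivative_jensenPoly_add_two (γ : ℕ → ℝ) (d n : ℕ) (x : ℝ) :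
    (derivative (derivative (jensenPoly γ (d + 2) n))).eval x =
      ((d : ℝ) + 2) * ((d : ℝ) + 1) * (jensenPoly γ d (n + 2)).eval x := by
  rw [derivative_derivative_jensenPoly, eval_mul, eval_C]

/-- **Necessity of the flow invariant (cell by cell).** If `J^{d+2,n}_γ` is hyperbolic then the
anti-diagonal Turán determinant `D_{d+2,n} := (J^{d+1,n+1}_γ)² − J^{d+2,n}_γ·J^{d,n+2}_γ` is `≥ 0`
on all of `ℝ`: by the shift rule `D_{d+2,n} = [(d+1)p′² − (d+2)pp″]/((d+2)²(d+1))`, `p = J^{d+2,n}_γ`,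
and this is the degree-aware Laguerre inequality (`laguerre_newton_of_splits`, `deg p ≤ d + 2`).
In particular on the Laguerre–Pólya side (`splits_jensenPoly_taylor_of_zeros_real`) every cell of the
Jensen grid carries `D ≥ 0` — the finite-degree form of the Laguerre inequality
`L₁(F⁽ⁿ⁾) = (F⁽ⁿ⁺¹⁾)² − F⁽ⁿ⁾F⁽ⁿ⁺²⁾ ≥ 0`. [cite: CravenCsordas1989, §1 (Laguerre and Turán inequalities
for the Jensen polynomials of 𝓛𝓟 functions)] -/
theorem eval_antiTuranDet_nonneg_of_splits (γ : ℕ → ℝ) {d n : ℕ}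
    (h : (jensenPoly γ (d + 2) n).Splits) (x : ℝ) :
    0 ≤ (jensenPoly γ (d + 1) (n + 1) ^ 2 - jensenPoly γ (d + 2) n * jensenPoly γ d (n + 2)).eval x := by
  have hLN := laguerre_newton_of_splits h (PolyaSchur.natDegree_jensenPoly_le γ (d + 2) n) x
  have e1 := eval_derivative_jensenPoly_add_two γ d n x
  have e2 := eval_derivative_derivative_jensenPoly_add_two γ d n x
  rw [e1, e2] at hLN
  push_cast at hLN
  simp only [eval_sub, eval_mul, eval_pow]
  have hpos : (0 : ℝ) < ((d : ℝ) + 2) ^ 2 * ((d : ℝ) + 1) := by positivity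
  refine (mul_nonneg_iff_of_pos_left hpos).mp ?_
  have hid : ((d : ℝ) + 2) ^ 2 * ((d : ℝ) + 1) *
      ((jensenPoly γ (d + 1) (n + 1)).eval x ^ 2 -
        (jensenPoly γ (d + 2) n).eval x * (jensenPoly γ d (n + 2)).eval x) =
      ((d : ℝ) + 2 - 1) * (((d : ℝ) + 2) * (jensenPoly γ (d + 1) (n + 1)).eval x) ^ 2 -
        ((d : ℝ) + 2) * ((jensenPoly γ (d + 2) n).eval x *
          (((d : ℝ) + 2) * ((d : ℝ) + 1) * (jensenPoly γ d (n + 2)).eval x)) := by ring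
  rw [hid]
  exact hLN

end Literature.Analysis.Complex.JensenLaguerreFlow
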